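import Literature.NumberTheory.GaloisCohomology.Howard2004.EigenSelmerLineCountProofs
import Literature.NumberTheory.GaloisCohomology.Howard2004.ResidualSelmerEigenParityProofs
import Literature.NumberTheory.GaloisCohomology.Howard2004.ResidualSelfOrthogonalProofs
import Literature.NumberTheory.GaloisCohomology.Howard2004.ResidualTateDualBijectiveProofs
import Literature.NumberTheory.GaloisCohomology.Howard2004.DVRSettingEngineStub
import Literature.NumberTheory.GaloisRepresentations.ContinuousH2OrderTwo
import HarnessLib

/-!
# Howard 2004, Lemma 1.5.3 on a `DVRSetting`: the (GD-line) count and the dichotomy (DICH) at an engine prime,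
# at the RESIDUAL level, modulo the local letters at the prime (proofs file, GD-LINE-S part R7-core)

Topic `NumberTheory/GaloisCohomology/Howard2004` (sequel to `EigenSelmerLineCountProofs` — w5's (GD-line) count
`length_R loc_q(S ⊓ E^ε) = 1` modulo fifteen named letters —, `EigenSelmerDichotomyProofs` — (DICH)
`loc_q(S ⊓ E^ε) ≤ H¹_f ∨ ≤ H¹_tr` modulo letters —, `ResidualSelmerEigenpartsProofs` / `ResidualSelmerEigenParityProofs`
— the residual structure `F̄_k`, its `τ_*`- and `R_k`-stability witnesses —, `ResidualSelfOrthogonalProofs` — H.4 for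
`F̄_k` —, `ResidualTateDualBijectiveProofs` — `T̄` finite).  THEOREMS ONLY: no definition, no named fact, no instance,
no notation, no `sorry`.

B. Howard, *The Heegner point Kolyvagin system*, Compositio Math. **140** (2004) = arXiv:1202.6340, Lemma 1.5.3, proof
(p. 10 L10–19, L27–40): «By global duality the images of the rightmost arrows are exact orthogonal complements under the
`G_ℚ`-invariant local Tate pairing. Furthermore the action of complex conjugation splits `H¹_f(K_ℓ, T̄)` and
`H¹_s(K_ℓ, T̄)` each into one-dimensional eigenspaces … the localization of `H¹_{F^ℓ(n)}(K, T̄)^±` at `ℓ` is a maximal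
isotropic subspace of `H¹(K_ℓ, T̄)^±` and … the only two such subspaces are `H¹_f(K_ℓ, T̄)^±` and `H¹_tr(K_ℓ, T̄)^±`.»
These two consequences are the binders `hGDp/hGDm` ((GD-line)±) and `horp/horm` ((DICH)±) of the ENGINE's Čebotarev
bricks `DVRSetting.exists_enginePrime_caseI/II` (`DVRSettingEngineChebProofs`).  THIS FILE instantiates the two
generic theorems at level `k` of a `DVRSetting S` (`hy : S.SatisfiesH`), for the residual representation `T̄ = S.ρbar`
over `R_k`, ANY residual duality datum `D̄` with H.5(c) (`hθ`, cf. `exists_residualDualityDatum`), an engine prime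
`v ∈ 𝓛^{(2k-1)}`, `v ∉ n ⊆ 𝓛^{(2k-1)}`, `S := H¹_{F̄_k^v(n)}(K, T̄)`, `E^± := ker(τ_* ∓ 1)`, `Lf := F̄_k,v`,
`Lt := H¹_tr(K_v, T̄)`, DISCHARGING the structural letters — `hE`, `τ_*`-stability of `S` (H.5(b) residual,
`semilinearH_mem_residualSelmer_modify`), `R_k`-stability of `S`, `S ⊓ E`, `Lf`, `Lt`, `τ_v`-stability of `Lf` (H.5(b))
and `Lt` (`TransportTransverseProofs`), isotropy of `Lf` (H.4 residual, `isSelfOrthogonal_residualStructure`), `p`- and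
`𝔪`-torsion of `H¹(K_v, T̄)`, `2`-torsion-freeness of `H²(K_v, R_k(1))`, finiteness — and KEEPING AS BINDERS the LOCAL
letters at `v` that the cell's split (LEAD g12 ruling 2026-08-29T08:05Z) assigns to other files: `hiso` / `hnd` /
`horth` / `ht` (R5: isotropy of `loc_v S` and of `Lt`, non-degeneracy, `ε ⊥ -ε`), `hcard` (R4: `#A·#A = #H¹(K_v,T̄)`),
`hdis` / `hsplit` (R3: Prop. 1.1.9 for `T̄`), `hdecf/hdect/hlinef/hlinet/hwitf/hwitt` (R6: the eigenLINES of `τ_v`).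

* §1 `engine_gd_dich_at` — at one `v`: (GD-line)⁺ ∧ (GD-line)⁻ ∧ (DICH)⁺ ∧ (DICH)⁻, conclusions VERBATIM in the
  binder shapes of `exists_enginePrime_caseI` (same `submoduleOfStable` witnesses).
* §2 `engine_hGD_of_letters`, `engine_hor_of_letters` — the four ENGINE binders `hGDp`, `hGDm`, `horp`, `horm` over
  all `v ∈ 𝓛^{(2k-1)} ∖ n` from the letters over all such `v`; `engine_hdis_of_isCompl` — `hdis` from Prop. 1.1.9.

Cell `pub/bsd-print-x9`, G87 = Howard Thm. 1.6.1 (print leaf `stub_h161` of stmt-BirchSwinnertonDyer-22642); seat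
`bsd-line-x10b-p1-w8` g11, brick (GD-LINE-S) R7-core.  HONEST FRAMING: the local letters are NOT discharged here;
`thm161_dvrKolyvaginBound` is NOT proved; no summit statement is proved; the Birch–Swinnerton-Dyer conjecture is not
proved by any of this.

References: [Howard2004HeegnerKolyvagin] Lemma 1.5.3, Lemma 1.5.6, Prop. 1.1.7, Prop. 1.1.9, H.4, H.5.
-/

set_option autoImplicit false

noncomputable section

open Function NumberField IsDedekindDomain Field
open scoped NumberField ContRepresentation Classical

namespace Literature.NumberTheory.GaloisCohomology.Howard2004

open Literature.NumberTheory.GaloisRepresentations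
open Literature.NumberTheory.GaloisRepresentations.DiscreteGaloisModule
open Literature.NumberTheory.EllipticCurves

/-! ## §0 Casting a class along an equality of places -/

section Cast

variable {K : Type} [Field K] [NumberField K] {M : Type} [AddCommGroup M] [TopologicalSpace M]
  [DiscreteTopology M] {ρ : DiscreteGaloisModule K M}

/-- Membership in a Selmer structure is transported along an equality of finite places `v = w`.
[cite: Howard2004HeegnerKolyvagin, §1.3 (arXiv:1202.6340 p. 7 L44–48: «`v̄ = v^τ`» at a degree-two prime)] -/
private theorem cast_mem_selmerStructure (𝓕 : SelmerStructure ρ) {v w : HeightOneSpectrum (𝓞 K)} (e : v = w)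
    {u : galoisCohomology (ρ.toLocal (Sum.inr v)) 1} (hu : u ∈ 𝓕 (Sum.inr v)) :
    (e ▸ u : galoisCohomology (ρ.toLocal (Sum.inr w)) 1) ∈ 𝓕 (Sum.inr w) := by
  subst e
  exact hu

end Cast

namespace DVRSetting

variable {p : ℕ} [Fact p.Prime] {K : Type} [Field K] [NumberField K]
  {R : Type} [CommRing R] [IsDomain R] [IsDiscreteValuationRing R] [Algebra ℤ_[p] R]
  {N : ℕ → Type} [∀ k, AddCommGroup (N k)] [∀ k, TopologicalSpace (N k)]
  [∀ k, DiscreteTopology (N k)] [∀ k, Module R (N k)]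
  {Rk : ℕ → Type} [∀ k, CommRing (Rk k)] [∀ k, IsLocalRing (Rk k)] [∀ k, TopologicalSpace (Rk k)]
  [∀ k, DiscreteTopology (Rk k)] [∀ k, Algebra ℤ_[p] (Rk k)] [∀ k, Algebra R (Rk k)]
  [∀ k, Module (Rk k) (N k)] [∀ k, IsScalarTower R (Rk k) (N k)]
  {Nbar : Type} [AddCommGroup Nbar] [TopologicalSpace Nbar] [DiscreteTopology Nbar]
  [∀ k, Module (Rk k) Nbar]
  {Nq : ℕ → Finset (HeightOneSpectrum (𝓞 K)) → Type} [∀ k n, AddCommGroup (Nq k n)]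
  [∀ k n, TopologicalSpace (Nq k n)] [∀ k n, DiscreteTopology (Nq k n)]
  [∀ k n, Module (Rk k) (Nq k n)] [∀ k n, Module R (Nq k n)]
  [∀ k n, IsScalarTower R (Rk k) (Nq k n)]

/-! ## §1 (GD-line)± and (DICH)± at one engine prime, modulo the local letters at that prime -/

/-- **Lemma 1.5.3 at the residual level, at ONE engine prime `v ∉ n`, modulo the local letters at `v`**: for
`S = H¹_{F̄_k^v(n)}(K, T̄)`, `E^± = ker(τ_* ∓ 1)`, `Lf = F̄_{k,v}`, `Lt = H¹_tr(K_v, T̄)` and any residual duality datum `D̄`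
with H.5(c) (`hθ`): **(GD-line)⁺ ∧ (GD-line)⁻** (`length_{R_k} loc_v(S ⊓ E^±) = 1`, in the `submoduleOfStable`
currency of `exists_enginePrime_caseI`) **∧ (DICH)⁺ ∧ (DICH)⁻** (`loc_v(S ⊓ E^±) ≤ Lf ∨ ≤ Lt`).  Discharged here:
`hE`, `hS` (H.5(b) residual), the `R_k`-stabilities, `τ_v`-stability of `Lf` (H.5(b)) and `Lt`, isotropy of `Lf`
(H.4 residual), `p · H¹(K_v,T̄) = 0`, `𝔪 · H¹(K_v,T̄) = 0`, `2`-torsion-freeness of `H²(K_v, R_k(1))`, finiteness.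
Binders: isotropy of `loc_v S` (`hiso`), the count (`hcard`), Prop. 1.1.9 (`hdis`, `hsplit`), isotropy of `Lt` (`ht`),
the `τ_v`-eigenlines of `Lf`, `Lt` (`hdecf/hdect/hlinef/hlinet/hwitf/hwitt`), `ε ⊥ -ε` (`horth`), non-degeneracy (`hnd`).
[cite: Howard2004HeegnerKolyvagin, Lemma 1.5.3 proof (arXiv:1202.6340 p. 10 L10–19, L27–40) with Lemma 1.5.6, Prop. 1.1.7, Prop. 1.1.9] -/
theorem engine_gd_dich_at [Finite Nbar] (S : DVRSetting p K R N Rk Nbar Nq) (hy : S.SatisfiesH) (k : ℕ)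
    (Dbar : DualityDatum p S.cd S.ρbar (Rk k))
    (hDbar : ∀ s t : N k, Dbar.e (S.πbar k s) (S.πbar k t) =
      algebraMap R (Rk k) S.π ^ (S.e k - 1) * (S.D k).e s t)
    (hθ : ∀ x y : Nbar, Dbar.e ((S.A k).θ x) ((S.A k).θ y) = -Dbar.e x y)
    {n : Finset (HeightOneSpectrum (𝓞 K))} (hn : ↑n ⊆ S.enginePrimes k)
    {v : HeightOneSpectrum (𝓞 K)} (hv : v ∈ S.enginePrimes k)
    (hiso : ∀ c ∈ ((((hy.h1 k).1.propagateStructure (S.t k).cond).modify (transverseStructure p S.ρbar S.jbar) {v} ∅ n).selmerGroup), ∀ d ∈ ((((hy.h1 k).1.propagateStructure (S.t k).cond).modify (transverseStructure p S.ρbar S.jbar) {v} ∅ n).selmerGroup),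
      Dbar.localCup (Sum.inr v) ((galoisCohomology.localization S.ρbar (Sum.inr v) 1) c) (S.cd.transportH1 S.ρbar v ((S.sigma_smul_eq_self_of_mem_L hy (S.enginePrimes_subset_L k hv)).symm ▸ (galoisCohomology.localization S.ρbar (Sum.inr v) 1) d : galoisCohomology (S.ρbar.toLocal (Sum.inr (S.cd.σ • v))) 1)) = 0)
    (hcard : Nat.card ↥(((((hy.h1 k).1.propagateStructure (S.t k).cond).modify (transverseStructure p S.ρbar S.jbar) {v} ∅ n).selmerGroup).map (galoisCohomology.localization S.ρbar (Sum.inr v) 1)) * Nat.card ↥(((((hy.h1 k).1.propagateStructure (S.t k).cond).modify (transverseStructure p S.ρbar S.jbar) {v} ∅ n).selmerGroup).map (galoisCohomology.localization S.ρbar (Sum.inr v) 1)) =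
      Nat.card (galoisCohomology (S.ρbar.toLocal (Sum.inr v)) 1))
    (hdis : Disjoint (((hy.h1 k).1.propagateStructure (S.t k).cond) (Sum.inr v)) ((transverseStructure p S.ρbar S.jbar) (Sum.inr v)))
    (hsplit : ∀ y : galoisCohomology (S.ρbar.toLocal (Sum.inr v)) 1, ∃ a ∈ (((hy.h1 k).1.propagateStructure (S.t k).cond) (Sum.inr v)), ∃ b ∈ ((transverseStructure p S.ρbar S.jbar) (Sum.inr v)), y = a + b)
    (ht : ∀ y ∈ ((transverseStructure p S.ρbar S.jbar) (Sum.inr v)), ∀ y' ∈ ((transverseStructure p S.ρbar S.jbar) (Sum.inr v)), Dbar.localCup (Sum.inr v) y (S.cd.transportH1 S.ρbar v ((S.sigma_smul_eq_self_of_mem_L hy (S.enginePrimes_subset_L k hv)).symm ▸ y' : galoisCohomology (S.ρbar.toLocal (Sum.inr (S.cd.σ • v))) 1)) = 0)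
    (hdecf : ∀ b ∈ (((hy.h1 k).1.propagateStructure (S.t k).cond) (Sum.inr v)), ∃ b₁ ∈ (((hy.h1 k).1.propagateStructure (S.t k).cond) (Sum.inr v)), ∃ b₂ ∈ (((hy.h1 k).1.propagateStructure (S.t k).cond) (Sum.inr v)),
      (S.A k).thetaH1 (Sum.inr v) (S.cd.transportH1 S.ρbar v ((S.sigma_smul_eq_self_of_mem_L hy (S.enginePrimes_subset_L k hv)).symm ▸ b₁ : galoisCohomology (S.ρbar.toLocal (Sum.inr (S.cd.σ • v))) 1)) = b₁ ∧
        (S.A k).thetaH1 (Sum.inr v) (S.cd.transportH1 S.ρbar v ((S.sigma_smul_eq_self_of_mem_L hy (S.enginePrimes_subset_L k hv)).symm ▸ b₂ : galoisCohomology (S.ρbar.toLocal (Sum.inr (S.cd.σ • v))) 1)) = -b₂ ∧ b = b₁ + b₂)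
    (hdect : ∀ b ∈ ((transverseStructure p S.ρbar S.jbar) (Sum.inr v)), ∃ b₁ ∈ ((transverseStructure p S.ρbar S.jbar) (Sum.inr v)), ∃ b₂ ∈ ((transverseStructure p S.ρbar S.jbar) (Sum.inr v)),
      (S.A k).thetaH1 (Sum.inr v) (S.cd.transportH1 S.ρbar v ((S.sigma_smul_eq_self_of_mem_L hy (S.enginePrimes_subset_L k hv)).symm ▸ b₁ : galoisCohomology (S.ρbar.toLocal (Sum.inr (S.cd.σ • v))) 1)) = b₁ ∧
        (S.A k).thetaH1 (Sum.inr v) (S.cd.transportH1 S.ρbar v ((S.sigma_smul_eq_self_of_mem_L hy (S.enginePrimes_subset_L k hv)).symm ▸ b₂ : galoisCohomology (S.ρbar.toLocal (Sum.inr (S.cd.σ • v))) 1)) = -b₂ ∧ b = b₁ + b₂)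
    (hlinef : ∀ ε' : ℤ, ε' = 1 ∨ ε' = -1 → ∀ w ∈ (((hy.h1 k).1.propagateStructure (S.t k).cond) (Sum.inr v)), (S.A k).thetaH1 (Sum.inr v) (S.cd.transportH1 S.ρbar v ((S.sigma_smul_eq_self_of_mem_L hy (S.enginePrimes_subset_L k hv)).symm ▸ w : galoisCohomology (S.ρbar.toLocal (Sum.inr (S.cd.σ • v))) 1)) = ε' • w → w ≠ 0 →
      ∀ b ∈ (((hy.h1 k).1.propagateStructure (S.t k).cond) (Sum.inr v)), (S.A k).thetaH1 (Sum.inr v) (S.cd.transportH1 S.ρbar v ((S.sigma_smul_eq_self_of_mem_L hy (S.enginePrimes_subset_L k hv)).symm ▸ b : galoisCohomology (S.ρbar.toLocal (Sum.inr (S.cd.σ • v))) 1)) = ε' • b → ∃ r : Rk k, b = galoisCohomology.scalarMapH1 (S.ρbar.toLocal (Sum.inr v)) (DualityDatum.isScalarLinear_toLocal (S.isScalarLinear_rhobar hy k) (Sum.inr v)) r w)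
    (hlinet : ∀ ε' : ℤ, ε' = 1 ∨ ε' = -1 → ∀ w ∈ ((transverseStructure p S.ρbar S.jbar) (Sum.inr v)), (S.A k).thetaH1 (Sum.inr v) (S.cd.transportH1 S.ρbar v ((S.sigma_smul_eq_self_of_mem_L hy (S.enginePrimes_subset_L k hv)).symm ▸ w : galoisCohomology (S.ρbar.toLocal (Sum.inr (S.cd.σ • v))) 1)) = ε' • w → w ≠ 0 →
      ∀ b ∈ ((transverseStructure p S.ρbar S.jbar) (Sum.inr v)), (S.A k).thetaH1 (Sum.inr v) (S.cd.transportH1 S.ρbar v ((S.sigma_smul_eq_self_of_mem_L hy (S.enginePrimes_subset_L k hv)).symm ▸ b : galoisCohomology (S.ρbar.toLocal (Sum.inr (S.cd.σ • v))) 1)) = ε' • b → ∃ r : Rk k, b = galoisCohomology.scalarMapH1 (S.ρbar.toLocal (Sum.inr v)) (DualityDatum.isScalarLinear_toLocal (S.isScalarLinear_rhobar hy k) (Sum.inr v)) r w)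
    (hwitf : ∀ ε' : ℤ, ε' = 1 ∨ ε' = -1 → ∃ w ∈ (((hy.h1 k).1.propagateStructure (S.t k).cond) (Sum.inr v)), w ≠ 0 ∧ (S.A k).thetaH1 (Sum.inr v) (S.cd.transportH1 S.ρbar v ((S.sigma_smul_eq_self_of_mem_L hy (S.enginePrimes_subset_L k hv)).symm ▸ w : galoisCohomology (S.ρbar.toLocal (Sum.inr (S.cd.σ • v))) 1)) = ε' • w)
    (hwitt : ∀ ε' : ℤ, ε' = 1 ∨ ε' = -1 → ∃ w ∈ ((transverseStructure p S.ρbar S.jbar) (Sum.inr v)), w ≠ 0 ∧ (S.A k).thetaH1 (Sum.inr v) (S.cd.transportH1 S.ρbar v ((S.sigma_smul_eq_self_of_mem_L hy (S.enginePrimes_subset_L k hv)).symm ▸ w : galoisCohomology (S.ρbar.toLocal (Sum.inr (S.cd.σ • v))) 1)) = ε' • w)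
    (horth : ∀ x y : galoisCohomology (S.ρbar.toLocal (Sum.inr v)) 1, (S.A k).thetaH1 (Sum.inr v) (S.cd.transportH1 S.ρbar v ((S.sigma_smul_eq_self_of_mem_L hy (S.enginePrimes_subset_L k hv)).symm ▸ x : galoisCohomology (S.ρbar.toLocal (Sum.inr (S.cd.σ • v))) 1)) = x → (S.A k).thetaH1 (Sum.inr v) (S.cd.transportH1 S.ρbar v ((S.sigma_smul_eq_self_of_mem_L hy (S.enginePrimes_subset_L k hv)).symm ▸ y : galoisCohomology (S.ρbar.toLocal (Sum.inr (S.cd.σ • v))) 1)) = -y →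
      Dbar.localCup (Sum.inr v) x (S.cd.transportH1 S.ρbar v ((S.sigma_smul_eq_self_of_mem_L hy (S.enginePrimes_subset_L k hv)).symm ▸ y : galoisCohomology (S.ρbar.toLocal (Sum.inr (S.cd.σ • v))) 1)) = 0 ∧ Dbar.localCup (Sum.inr v) y (S.cd.transportH1 S.ρbar v ((S.sigma_smul_eq_self_of_mem_L hy (S.enginePrimes_subset_L k hv)).symm ▸ x : galoisCohomology (S.ρbar.toLocal (Sum.inr (S.cd.σ • v))) 1)) = 0)
    (hnd : ∀ u : galoisCohomology (S.ρbar.toLocal (Sum.inr v)) 1, (∀ y, Dbar.localCup (Sum.inr v) u (S.cd.transportH1 S.ρbar v ((S.sigma_smul_eq_self_of_mem_L hy (S.enginePrimes_subset_L k hv)).symm ▸ y : galoisCohomology (S.ρbar.toLocal (Sum.inr (S.cd.σ • v))) 1)) = 0) → u = 0) :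
    letI := galoisCohomology.moduleH1 (S.ρbar.toLocal (Sum.inr v))
      ((S.isScalarLinear_rhobar hy k).restrictField (Place.Completion (Sum.inr v)))
    (Module.length (Rk k) ↥(galoisCohomology.submoduleOfStable ((S.isScalarLinear_rhobar hy k).restrictField (Place.Completion (Sum.inr v)))
        ((((((hy.h1 k).1.propagateStructure (S.t k).cond).modify (transverseStructure p S.ρbar S.jbar) {v} ∅ n).selmerGroup) ⊓
          (semilinearH S.cd.isLift (S.A k).θ.toAddMonoidHom (S.A k).isSemilinear 1 - AddMonoidHom.id _).ker).map
          (galoisCohomology.localization S.ρbar (Sum.inr v) 1))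
        (scalarMapH1_mem_map_localization S.ρbar (S.isScalarLinear_rhobar hy k) (Sum.inr v) (scalarMapH1_mem_inf S.ρbar (S.isScalarLinear_rhobar hy k) (S.scalarMapH1_mem_residualSelmer_modify hy k {v} ∅ n) (S.scalarMapH1_mem_kerSub hy k)))) = 1) ∧
    (Module.length (Rk k) ↥(galoisCohomology.submoduleOfStable ((S.isScalarLinear_rhobar hy k).restrictField (Place.Completion (Sum.inr v)))
        ((((((hy.h1 k).1.propagateStructure (S.t k).cond).modify (transverseStructure p S.ρbar S.jbar) {v} ∅ n).selmerGroup) ⊓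
          (semilinearH S.cd.isLift (S.A k).θ.toAddMonoidHom (S.A k).isSemilinear 1 + AddMonoidHom.id _).ker).map
          (galoisCohomology.localization S.ρbar (Sum.inr v) 1))
        (scalarMapH1_mem_map_localization S.ρbar (S.isScalarLinear_rhobar hy k) (Sum.inr v) (scalarMapH1_mem_inf S.ρbar (S.isScalarLinear_rhobar hy k) (S.scalarMapH1_mem_residualSelmer_modify hy k {v} ∅ n) (S.scalarMapH1_mem_kerAdd hy k)))) = 1) ∧
    ((((((hy.h1 k).1.propagateStructure (S.t k).cond).modify (transverseStructure p S.ρbar S.jbar) {v} ∅ n).selmerGroup) ⊓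
          (semilinearH S.cd.isLift (S.A k).θ.toAddMonoidHom (S.A k).isSemilinear 1 - AddMonoidHom.id _).ker).map (galoisCohomology.localization S.ρbar (Sum.inr v) 1) ≤ (((hy.h1 k).1.propagateStructure (S.t k).cond) (Sum.inr v)) ∨
      (((((hy.h1 k).1.propagateStructure (S.t k).cond).modify (transverseStructure p S.ρbar S.jbar) {v} ∅ n).selmerGroup) ⊓
          (semilinearH S.cd.isLift (S.A k).θ.toAddMonoidHom (S.A k).isSemilinear 1 - AddMonoidHom.id _).ker).map (galoisCohomology.localization S.ρbar (Sum.inr v) 1) ≤ ((transverseStructure p S.ρbar S.jbar) (Sum.inr v))) ∧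
    ((((((hy.h1 k).1.propagateStructure (S.t k).cond).modify (transverseStructure p S.ρbar S.jbar) {v} ∅ n).selmerGroup) ⊓
          (semilinearH S.cd.isLift (S.A k).θ.toAddMonoidHom (S.A k).isSemilinear 1 + AddMonoidHom.id _).ker).map (galoisCohomology.localization S.ρbar (Sum.inr v) 1) ≤ (((hy.h1 k).1.propagateStructure (S.t k).cond) (Sum.inr v)) ∨
      (((((hy.h1 k).1.propagateStructure (S.t k).cond).modify (transverseStructure p S.ρbar S.jbar) {v} ∅ n).selmerGroup) ⊓
          (semilinearH S.cd.isLift (S.A k).θ.toAddMonoidHom (S.A k).isSemilinear 1 + AddMonoidHom.id _).ker).map (galoisCohomology.localization S.ρbar (Sum.inr v) 1) ≤ ((transverseStructure p S.ρbar S.jbar) (Sum.inr v))) := by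
  letI instL := galoisCohomology.moduleH1 (S.ρbar.toLocal (Sum.inr v))
    ((S.isScalarLinear_rhobar hy k).restrictField (Place.Completion (Sum.inr v)))
  have hp : p.Prime := Fact.out
  haveI : Finite (Rk k) := S.finite_coeffLevel hy k
  haveI : Finite (Rk k ⧸ IsLocalRing.maximalIdeal (Rk k)) :=
    Finite.of_surjective (Ideal.Quotient.mk (IsLocalRing.maximalIdeal (Rk k))) Ideal.Quotient.mk_surjective
  haveI : Finite (galoisCohomology (S.ρbar.toLocal (Sum.inr v)) 1) := finite_galoisCohomology_one_toLocal S.ρbar v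
  have hfix : S.cd.σ • v = v := (S.sigma_smul_eq_self_of_mem_L hy (S.enginePrimes_subset_L k hv))
  have hvL : v ∈ S.L := S.enginePrimes_subset_L k hv
  have hσa : ∀ w ∈ ({v} : Finset (HeightOneSpectrum (𝓞 K))), S.cd.σ • w = w := fun w hw => by
    rw [Finset.mem_singleton] at hw
    rw [hw, hfix]
  have hσn : ∀ w ∈ n, S.cd.σ • w = w := fun w hw =>
    S.sigma_smul_eq_self_of_mem_L hy (S.enginePrimes_subset_L k (hn hw))
  -- torsion facts
  have hk' : ((p : ℕ) : R) ^ S.e k ∈ IsLocalRing.maximalIdeal R ^ S.e k :=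
    S.natCast_pow_mem_maximalIdeal_pow_of_le hy le_rfl
  have hRk : ∀ r : Rk k, p ^ S.e k • r = 0 := S.natCast_pow_smul_levelRing_eq_zero hy k hk'
  have hoddpe : Odd (p ^ S.e k) := (hp.odd_of_ne_two hy.p_odd).pow
  -- the structural letters
  have hEp : ∀ c : galoisCohomology S.ρbar 1, c ∈ (semilinearH S.cd.isLift (S.A k).θ.toAddMonoidHom (S.A k).isSemilinear 1 - AddMonoidHom.id _).ker ↔ semilinearH S.cd.isLift (S.A k).θ.toAddMonoidHom (S.A k).isSemilinear 1 c = (1 : ℤ) • c := fun c => by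
    rw [ResidualTau.mem_ker_sub_iff, one_zsmul]
  have hEm : ∀ c : galoisCohomology S.ρbar 1, c ∈ (semilinearH S.cd.isLift (S.A k).θ.toAddMonoidHom (S.A k).isSemilinear 1 + AddMonoidHom.id _).ker ↔ semilinearH S.cd.isLift (S.A k).θ.toAddMonoidHom (S.A k).isSemilinear 1 c = (-1 : ℤ) • c := fun c => by
    rw [ResidualTau.mem_ker_add_iff, neg_one_zsmul]
  have hS : ∀ c ∈ ((((hy.h1 k).1.propagateStructure (S.t k).cond).modify (transverseStructure p S.ρbar S.jbar) {v} ∅ n).selmerGroup), semilinearH S.cd.isLift (S.A k).θ.toAddMonoidHom (S.A k).isSemilinear 1 c ∈ ((((hy.h1 k).1.propagateStructure (S.t k).cond).modify (transverseStructure p S.ρbar S.jbar) {v} ∅ n).selmerGroup) :=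
    fun c hc => S.semilinearH_mem_residualSelmer_modify hy k hσa hσn hc
  have hAS := scalarMapH1_mem_map_localization S.ρbar (S.isScalarLinear_rhobar hy k) (Sum.inr v)
    (S.scalarMapH1_mem_residualSelmer_modify hy k {v} ∅ n)
  have hLf : ∀ (r : Rk k) {x : galoisCohomology (S.ρbar.toLocal (Sum.inr v)) 1}, x ∈ (((hy.h1 k).1.propagateStructure (S.t k).cond) (Sum.inr v)) →
      galoisCohomology.scalarMapH1 (S.ρbar.toLocal (Sum.inr v)) ((S.isScalarLinear_rhobar hy k).restrictField (Place.Completion (Sum.inr v)))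
        r x ∈ (((hy.h1 k).1.propagateStructure (S.t k).cond) (Sum.inr v)) :=
    fun r _ hx => S.isScalarStable_residualStructure hy k (Sum.inr v) r hx
  have hLt : ∀ (r : Rk k) {x : galoisCohomology (S.ρbar.toLocal (Sum.inr v)) 1}, x ∈ ((transverseStructure p S.ρbar S.jbar) (Sum.inr v)) →
      galoisCohomology.scalarMapH1 (S.ρbar.toLocal (Sum.inr v)) ((S.isScalarLinear_rhobar hy k).restrictField (Place.Completion (Sum.inr v)))
        r x ∈ ((transverseStructure p S.ρbar S.jbar) (Sum.inr v)) :=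
    fun r _ hx => isScalarStable_transverseStructure p (S.isScalarLinear_rhobar hy k) S.jbar (Sum.inr v) r hx
  have hstabf : ∀ u ∈ (((hy.h1 k).1.propagateStructure (S.t k).cond) (Sum.inr v)), (S.A k).thetaH1 (Sum.inr v) (S.cd.transportH1 S.ρbar v ((S.sigma_smul_eq_self_of_mem_L hy (S.enginePrimes_subset_L k hv)).symm ▸ u : galoisCohomology (S.ρbar.toLocal (Sum.inr (S.cd.σ • v))) 1)) ∈ (((hy.h1 k).1.propagateStructure (S.t k).cond) (Sum.inr v)) := fun u hu =>
    (hy.h5b k v).le ⟨_, cast_mem_selmerStructure ((hy.h1 k).1.propagateStructure (S.t k).cond) hfix.symm hu, rfl⟩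
  have hstabt : ∀ y ∈ ((transverseStructure p S.ρbar S.jbar) (Sum.inr v)), (S.A k).thetaH1 (Sum.inr v) (S.cd.transportH1 S.ρbar v ((S.sigma_smul_eq_self_of_mem_L hy (S.enginePrimes_subset_L k hv)).symm ▸ y : galoisCohomology (S.ρbar.toLocal (Sum.inr (S.cd.σ • v))) 1)) ∈ ((transverseStructure p S.ρbar S.jbar) (Sum.inr v)) := by
    intro y hy'
    have hℓ : ringChar (𝓞 K ⧸ v.asIdeal) ≠ 0 := (prime_residueChar v).ne_zero
    have hmem := cast_mem_selmerStructure (transverseStructure p S.ρbar S.jbar) hfix.symm hy'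
    rw [transverseStructure_inr] at hmem
    have hch : ringChar (𝓞 K ⧸ (S.cd.σ • v).asIdeal) = ringChar (𝓞 K ⧸ v.asIdeal) := by rw [hfix]
    rw [hch] at hmem
    rw [transverseStructure_inr]
    exact (S.A k).thetaH1_mem_transverseCondition _ S.jbar v
      (S.cd.transportH1_mem_transverseCondition_of_isImaginaryQuadratic hy.imagQuad S.ρbar S.jbar hℓ v hmem)
  have hf : ∀ u ∈ (((hy.h1 k).1.propagateStructure (S.t k).cond) (Sum.inr v)), ∀ u' ∈ (((hy.h1 k).1.propagateStructure (S.t k).cond) (Sum.inr v)), Dbar.localCup (Sum.inr v) u (S.cd.transportH1 S.ρbar v ((S.sigma_smul_eq_self_of_mem_L hy (S.enginePrimes_subset_L k hv)).symm ▸ u' : galoisCohomology (S.ρbar.toLocal (Sum.inr (S.cd.σ • v))) 1)) = 0 := fun u hu u' hu' =>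
    (S.isSelfOrthogonal_residualStructure hy k Dbar hDbar v).localCup_eq_zero hu
      (AddSubgroup.mem_map_of_mem _ (cast_mem_selmerStructure ((hy.h1 k).1.propagateStructure (S.t k).cond) hfix.symm hu'))
  have hodd : ∃ N₀ : ℕ, Odd N₀ ∧ ∀ x : galoisCohomology (S.ρbar.toLocal (Sum.inr v)) 1, N₀ • x = 0 :=
    ⟨p, hp.odd_of_ne_two hy.p_odd, fun x =>
      galoisCohomology.nsmul_eq_zero_of_forall (S.ρbar.toLocal (Sum.inr v)) (S.p_nsmul_residual_eq_zero hy) x⟩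
  have hm : ∀ a ∈ IsLocalRing.maximalIdeal (Rk k), ∀ x : galoisCohomology (S.ρbar.toLocal (Sum.inr v)) 1,
      galoisCohomology.scalarMapH1 (S.ρbar.toLocal (Sum.inr v)) ((S.isScalarLinear_rhobar hy k).restrictField (Place.Completion (Sum.inr v)))
        a x = 0 := fun a ha x =>
    galoisCohomology.smul_eq_zero_of_forall (S.ρbar.toLocal (Sum.inr v))
      ((S.isScalarLinear_rhobar hy k).restrictField (Place.Completion (Sum.inr v))) a (fun m => S.maximalIdeal_smul_residual_eq_zero hy k ha m) x
  have h2 : ∀ z : galoisCohomology (Dbar.twistOne.toLocal (Sum.inr v)) 2, 2 • z = 0 → z = 0 := by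
    haveI : CompactSpace (absoluteGaloisGroup (Place.Completion (Sum.inr v : Place K))) :=
      absoluteGaloisGroup_compactSpace _
    intro z hz
    exact Literature.NumberTheory.EllipticCurves.eq_zero_of_two_nsmul_eq_zero_of_odd hoddpe hz
      (nsmul_continuousCohomology_two_eq_zero_of_forall _ (fun r => hRk r) z)
  -- T3's combined eigenline letters
  have hdec : ∀ L : AddSubgroup (galoisCohomology (S.ρbar.toLocal (Sum.inr v)) 1), (L = (((hy.h1 k).1.propagateStructure (S.t k).cond) (Sum.inr v)) ∨ L = ((transverseStructure p S.ρbar S.jbar) (Sum.inr v))) →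
      ∀ b ∈ L, ∃ b₁ ∈ L, ∃ b₂ ∈ L, (S.A k).thetaH1 (Sum.inr v) (S.cd.transportH1 S.ρbar v ((S.sigma_smul_eq_self_of_mem_L hy (S.enginePrimes_subset_L k hv)).symm ▸ b₁ : galoisCohomology (S.ρbar.toLocal (Sum.inr (S.cd.σ • v))) 1)) = b₁ ∧ (S.A k).thetaH1 (Sum.inr v) (S.cd.transportH1 S.ρbar v ((S.sigma_smul_eq_self_of_mem_L hy (S.enginePrimes_subset_L k hv)).symm ▸ b₂ : galoisCohomology (S.ρbar.toLocal (Sum.inr (S.cd.σ • v))) 1)) = -b₂ ∧ b = b₁ + b₂ := by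
    rintro L (rfl | rfl)
    exacts [hdecf, hdect]
  have hline : ∀ L : AddSubgroup (galoisCohomology (S.ρbar.toLocal (Sum.inr v)) 1), (L = (((hy.h1 k).1.propagateStructure (S.t k).cond) (Sum.inr v)) ∨ L = ((transverseStructure p S.ρbar S.jbar) (Sum.inr v))) →
      ∀ ε' : ℤ, ε' = 1 ∨ ε' = -1 → ∀ w ∈ L, (S.A k).thetaH1 (Sum.inr v) (S.cd.transportH1 S.ρbar v ((S.sigma_smul_eq_self_of_mem_L hy (S.enginePrimes_subset_L k hv)).symm ▸ w : galoisCohomology (S.ρbar.toLocal (Sum.inr (S.cd.σ • v))) 1)) = ε' • w → w ≠ 0 →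
        ∀ b ∈ L, (S.A k).thetaH1 (Sum.inr v) (S.cd.transportH1 S.ρbar v ((S.sigma_smul_eq_self_of_mem_L hy (S.enginePrimes_subset_L k hv)).symm ▸ b : galoisCohomology (S.ρbar.toLocal (Sum.inr (S.cd.σ • v))) 1)) = ε' • b → ∃ r : Rk k, b = galoisCohomology.scalarMapH1 (S.ρbar.toLocal (Sum.inr v)) (DualityDatum.isScalarLinear_toLocal (S.isScalarLinear_rhobar hy k) (Sum.inr v)) r w := by
    rintro L (rfl | rfl)
    exacts [hlinef, hlinet]
  have hwit : ∀ L : AddSubgroup (galoisCohomology (S.ρbar.toLocal (Sum.inr v)) 1), (L = (((hy.h1 k).1.propagateStructure (S.t k).cond) (Sum.inr v)) ∨ L = ((transverseStructure p S.ρbar S.jbar) (Sum.inr v))) →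
      ∀ ε' : ℤ, ε' = 1 ∨ ε' = -1 → ∃ w ∈ L, w ≠ 0 ∧ (S.A k).thetaH1 (Sum.inr v) (S.cd.transportH1 S.ρbar v ((S.sigma_smul_eq_self_of_mem_L hy (S.enginePrimes_subset_L k hv)).symm ▸ w : galoisCohomology (S.ρbar.toLocal (Sum.inr (S.cd.σ • v))) 1)) = ε' • w := by
    rintro L (rfl | rfl)
    exacts [hwitf, hwitt]
  have hstabL : ∀ u ∈ (((hy.h1 k).1.propagateStructure (S.t k).cond) (Sum.inr v)), (S.A k).thetaH1 (Sum.inr v) (S.cd.transportH1 S.ρbar v ((S.sigma_smul_eq_self_of_mem_L hy (S.enginePrimes_subset_L k hv)).symm ▸ u : galoisCohomology (S.ρbar.toLocal (Sum.inr (S.cd.σ • v))) 1)) ∈ (((hy.h1 k).1.propagateStructure (S.t k).cond) (Sum.inr v)) := hstabf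
  -- (GD-line)±
  have hGD : ∀ {ε : ℤ} (hε : ε = 1 ∨ ε = -1) (E : AddSubgroup (galoisCohomology S.ρbar 1))
      (hE : ∀ c, c ∈ E ↔ semilinearH S.cd.isLift (S.A k).θ.toAddMonoidHom (S.A k).isSemilinear 1 c = ε • c)
      (hAE : ∀ (r : Rk k) {x}, x ∈ (((((hy.h1 k).1.propagateStructure (S.t k).cond).modify (transverseStructure p S.ρbar S.jbar) {v} ∅ n).selmerGroup) ⊓ E).map (galoisCohomology.localization S.ρbar (Sum.inr v) 1) →
        galoisCohomology.scalarMapH1 (S.ρbar.toLocal (Sum.inr v)) ((S.isScalarLinear_rhobar hy k).restrictField (Place.Completion (Sum.inr v)))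
          r x ∈ (((((hy.h1 k).1.propagateStructure (S.t k).cond).modify (transverseStructure p S.ρbar S.jbar) {v} ∅ n).selmerGroup) ⊓ E).map (galoisCohomology.localization S.ρbar (Sum.inr v) 1)),
      Module.length (Rk k) ↥(galoisCohomology.submoduleOfStable ((S.isScalarLinear_rhobar hy k).restrictField (Place.Completion (Sum.inr v)))
        ((((((hy.h1 k).1.propagateStructure (S.t k).cond).modify (transverseStructure p S.ρbar S.jbar) {v} ∅ n).selmerGroup) ⊓ E).map (galoisCohomology.localization S.ρbar (Sum.inr v) 1)) hAE) = 1 := by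
    intro ε hε E hE hAE
    exact Dbar.length_map_inf_eigen_eq_one (S.A k) (S.isScalarLinear_rhobar hy k) hfix hε ((((hy.h1 k).1.propagateStructure (S.t k).cond).modify (transverseStructure p S.ρbar S.jbar) {v} ∅ n).selmerGroup) E hE hS hAS hAE hiso hcard
      (((hy.h1 k).1.propagateStructure (S.t k).cond) (Sum.inr v)) ((transverseStructure p S.ρbar S.jbar) (Sum.inr v)) hdis hsplit hLf hLt hstabf hstabt hdec hline hwit horth hnd hodd hm
  -- (DICH)±
  have hDICH : ∀ {ε : ℤ} (hε : ε = 1 ∨ ε = -1) (E : AddSubgroup (galoisCohomology S.ρbar 1))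
      (hE : ∀ c ∈ E, semilinearH S.cd.isLift (S.A k).θ.toAddMonoidHom (S.A k).isSemilinear 1 c = ε • c),
      (((((hy.h1 k).1.propagateStructure (S.t k).cond).modify (transverseStructure p S.ρbar S.jbar) {v} ∅ n).selmerGroup) ⊓ E).map (galoisCohomology.localization S.ρbar (Sum.inr v) 1) ≤ (((hy.h1 k).1.propagateStructure (S.t k).cond) (Sum.inr v)) ∨ (((((hy.h1 k).1.propagateStructure (S.t k).cond).modify (transverseStructure p S.ρbar S.jbar) {v} ∅ n).selmerGroup) ⊓ E).map (galoisCohomology.localization S.ρbar (Sum.inr v) 1) ≤ ((transverseStructure p S.ρbar S.jbar) (Sum.inr v)) := by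
    intro ε hε E hE
    refine Dbar.map_inf_le_or_le_of_isotropic_of_eigen (S.A k) (S.isScalarLinear_rhobar hy k) hfix hθ hε ((((hy.h1 k).1.propagateStructure (S.t k).cond).modify (transverseStructure p S.ρbar S.jbar) {v} ∅ n).selmerGroup) E hE hiso (((hy.h1 k).1.propagateStructure (S.t k).cond) (Sum.inr v)) ((transverseStructure p S.ρbar S.jbar) (Sum.inr v))
      hdis hsplit hstabf hstabt hf ht (fun u _ w _ hu hw => ?_) (fun b hb => ?_) (fun w hw hεw hw0 b hb hεb => ?_)
      hnd h2
    · rcases hε with rfl | rfl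
      · rw [one_zsmul] at hu hw
        exact (horth u w hu hw).1
      · rw [neg_one_zsmul] at hu
        rw [neg_one_zsmul, neg_neg] at hw
        exact (horth w u hw hu).2
    · obtain ⟨b₁, hb₁, b₂, hb₂, h₁, h₂, rfl⟩ := hdect b hb
      rcases hε with rfl | rfl
      · exact ⟨b₁, hb₁, b₂, hb₂, by rw [one_zsmul, h₁], by rw [one_zsmul, h₂], rfl⟩
      · exact ⟨b₂, hb₂, b₁, hb₁, by rw [neg_one_zsmul, h₂], by rw [neg_one_zsmul, neg_neg, h₁], add_comm _ _⟩
    · exact hlinet ε hε w hw hεw hw0 b hb hεb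
  refine ⟨hGD (Or.inl rfl) _ hEp _, hGD (Or.inr rfl) _ hEm _, hDICH (Or.inl rfl) _ (fun c hc => (hEp c).1 hc),
    hDICH (Or.inr rfl) _ (fun c hc => (hEm c).1 hc)⟩


/-! ## §2 The ENGINE binders `hdis`, `hGDp/hGDm`, `horp/horm` over all engine primes off `n` -/

/-- **The ENGINE binder `hdis` of `exists_enginePrime_caseI/II` from Prop. 1.1.9 for `T̄`** (`H¹_f ⊕ H¹_tr = H¹(K_v, T̄)`
at the engine primes). [cite: Howard2004HeegnerKolyvagin, Prop. 1.1.9 (arXiv:1202.6340 p. 6 L17–25)] -/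
theorem engine_hdis_of_isCompl (S : DVRSetting p K R N Rk Nbar Nq) (hy : S.SatisfiesH) (k : ℕ)
    (n : Finset (HeightOneSpectrum (𝓞 K)))
    (hc : ∀ v ∈ S.enginePrimes k, IsCompl (((hy.h1 k).1.propagateStructure (S.t k).cond) (Sum.inr v)) ((transverseStructure p S.ρbar S.jbar) (Sum.inr v))) :
    ∀ v ∈ S.enginePrimes k, v ∉ n → Disjoint (((hy.h1 k).1.propagateStructure (S.t k).cond) (Sum.inr v)) ((transverseStructure p S.ρbar S.jbar) (Sum.inr v)) :=
  fun v hv _ => (hc v hv).disjoint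

/-- **Lemma 1.5.3 at the residual level over ALL engine primes off `n`: the four ENGINE binders `hGDp`, `hGDm`
((GD-line)±) and `horp`, `horm` ((DICH)±) of `DVRSetting.exists_enginePrime_caseI` / `…_caseII` VERBATIM**, from the
local letters at every engine prime (binders, to be supplied by the residual local files R3–R6 of the cell's split)
and the structural letters discharged in `engine_gd_dich_at`.
[cite: Howard2004HeegnerKolyvagin, Lemma 1.5.3 proof (arXiv:1202.6340 p. 10 L10–19, L27–40)] -/
theorem engine_gd_dich_of_letters [Finite Nbar] (S : DVRSetting p K R N Rk Nbar Nq) (hy : S.SatisfiesH) (k : ℕ)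
    (Dbar : DualityDatum p S.cd S.ρbar (Rk k))
    (hDbar : ∀ s t : N k, Dbar.e (S.πbar k s) (S.πbar k t) =
      algebraMap R (Rk k) S.π ^ (S.e k - 1) * (S.D k).e s t)
    (hθ : ∀ x y : Nbar, Dbar.e ((S.A k).θ x) ((S.A k).θ y) = -Dbar.e x y)
    {n : Finset (HeightOneSpectrum (𝓞 K))} (hn : ↑n ⊆ S.enginePrimes k)
    (hiso : ∀ (v : HeightOneSpectrum (𝓞 K)) (hv : v ∈ S.enginePrimes k), v ∉ n → ∀ c ∈ ((((hy.h1 k).1.propagateStructure (S.t k).cond).modify (transverseStructure p S.ρbar S.jbar) {v} ∅ n).selmerGroup), ∀ d ∈ ((((hy.h1 k).1.propagateStructure (S.t k).cond).modify (transverseStructure p S.ρbar S.jbar) {v} ∅ n).selmerGroup), Dbar.localCup (Sum.inr v) ((galoisCohomology.localization S.ρbar (Sum.inr v) 1) c) (S.cd.transportH1 S.ρbar v ((S.sigma_smul_eq_self_of_mem_L hy (S.enginePrimes_subset_L k hv)).symm ▸ (galoisCohomology.localization S.ρbar (Sum.inr v) 1) d : galoisCohomology (S.ρbar.toLocal (Sum.inr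 (S.cd.σ • v))) 1)) = 0)
    (hcard : ∀ (v : HeightOneSpectrum (𝓞 K)) (hv : v ∈ S.enginePrimes k), v ∉ n → Nat.card ↥(((((hy.h1 k).1.propagateStructure (S.t k).cond).modify (transverseStructure p S.ρbar S.jbar) {v} ∅ n).selmerGroup).map (galoisCohomology.localization S.ρbar (Sum.inr v) 1)) * Nat.card ↥(((((hy.h1 k).1.propagateStructure (S.t k).cond).modify (transverseStructure p S.ρbar S.jbar) {v} ∅ n).selmerGroup).map (galoisCohomology.localization S.ρbar (Sum.inr v) 1)) = Nat.card (galoisCohomology (S.ρbar.toLocal (Sum.inr v)) 1))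
    (hdis : ∀ (v : HeightOneSpectrum (𝓞 K)) (hv : v ∈ S.enginePrimes k), Disjoint (((hy.h1 k).1.propagateStructure (S.t k).cond) (Sum.inr v)) ((transverseStructure p S.ρbar S.jbar) (Sum.inr v)))
    (hsplit : ∀ (v : HeightOneSpectrum (𝓞 K)) (hv : v ∈ S.enginePrimes k), ∀ y : galoisCohomology (S.ρbar.toLocal (Sum.inr v)) 1, ∃ a ∈ (((hy.h1 k).1.propagateStructure (S.t k).cond) (Sum.inr v)), ∃ b ∈ ((transverseStructure p S.ρbar S.jbar) (Sum.inr v)), y = a + b)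
    (ht : ∀ (v : HeightOneSpectrum (𝓞 K)) (hv : v ∈ S.enginePrimes k), ∀ y ∈ ((transverseStructure p S.ρbar S.jbar) (Sum.inr v)), ∀ y' ∈ ((transverseStructure p S.ρbar S.jbar) (Sum.inr v)), Dbar.localCup (Sum.inr v) y (S.cd.transportH1 S.ρbar v ((S.sigma_smul_eq_self_of_mem_L hy (S.enginePrimes_subset_L k hv)).symm ▸ y' : galoisCohomology (S.ρbar.toLocal (Sum.inr (S.cd.σ • v))) 1)) = 0)
    (hdecf : ∀ (v : HeightOneSpectrum (𝓞 K)) (hv : v ∈ S.enginePrimes k), ∀ b ∈ (((hy.h1 k).1.propagateStructure (S.t k).cond) (Sum.inr v)), ∃ b₁ ∈ (((hy.h1 k).1.propagateStructure (S.t k).cond) (Sum.inr v)), ∃ b₂ ∈ (((hy.h1 k).1.propagateStructure (S.t k).cond) (Sum.inr v)), (S.A k).thetaH1 (Sum.inr v) (S.cd.transportH1 S.ρbar v ((S.sigma_smul_eq_self_of_mem_L hy (S.enginePrimes_subset_L k hv)).symm ▸ b₁ : galoisCohomology (S.ρbar.toLocal (Sum.inr (S.cd.σ • v))) 1)) = b₁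 ∧ (S.A k).thetaH1 (Sum.inr v) (S.cd.transportH1 S.ρbar v ((S.sigma_smul_eq_self_of_mem_L hy (S.enginePrimes_subset_L k hv)).symm ▸ b₂ : galoisCohomology (S.ρbar.toLocal (Sum.inr (S.cd.σ • v))) 1)) = -b₂ ∧ b = b₁ + b₂)
    (hdect : ∀ (v : HeightOneSpectrum (𝓞 K)) (hv : v ∈ S.enginePrimes k), ∀ b ∈ ((transverseStructure p S.ρbar S.jbar) (Sum.inr v)), ∃ b₁ ∈ ((transverseStructure p S.ρbar S.jbar) (Sum.inr v)), ∃ b₂ ∈ ((transverseStructure p S.ρbar S.jbar) (Sum.inr v)), (S.A k).thetaH1 (Sum.inr v) (S.cd.transportH1 S.ρbar v ((S.sigma_smul_eq_self_of_mem_L hy (S.enginePrimes_subset_L k hv)).symm ▸ b₁ : galoisCohomology (S.ρbar.toLocal (Sum.inr (S.cd.σ • v))) 1)) = b₁ ∧ (S.A k).thetaH1 (Sum.inr v) (S.cd.transportH1 S.ρbar v ((S.sigma_smul_eq_self_of_mem_L hy (S.enginePrimes_subset_L k hv)).symm ▸ b₂ : galoisCohomology (S.ρbar.toLocal (Sum.inr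 (S.cd.σ • v))) 1)) = -b₂ ∧ b = b₁ + b₂)
    (hlinef : ∀ (v : HeightOneSpectrum (𝓞 K)) (hv : v ∈ S.enginePrimes k), ∀ ε' : ℤ, ε' = 1 ∨ ε' = -1 → ∀ w ∈ (((hy.h1 k).1.propagateStructure (S.t k).cond) (Sum.inr v)), (S.A k).thetaH1 (Sum.inr v) (S.cd.transportH1 S.ρbar v ((S.sigma_smul_eq_self_of_mem_L hy (S.enginePrimes_subset_L k hv)).symm ▸ w : galoisCohomology (S.ρbar.toLocal (Sum.inr (S.cd.σ • v))) 1)) = ε' • w → w ≠ 0 → ∀ b ∈ (((hy.h1 k).1.propagateStructure (S.t k).cond) (Sum.inr v)), (S.A k).thetaH1 (Sum.inr v) (S.cd.transportH1 S.ρbar v ((S.sigma_smul_eq_self_of_mem_L hy (S.enginePrimes_subset_L k hv)).symm ▸ b : galoisCohomology (S.ρbar.toLocal (Sum.inr (S.cd.σ • v))) 1)) = ε' • b → ∃ r : Rk k, b = galoisCohomology.scalarMapH1 (S.ρbar.toLocal (Sum.inr v)) (DualityDatum.isScalarLinear_toLocal (S.isScalarLinear_rhobar hy k) (Sum.inr v))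 r w)
    (hlinet : ∀ (v : HeightOneSpectrum (𝓞 K)) (hv : v ∈ S.enginePrimes k), ∀ ε' : ℤ, ε' = 1 ∨ ε' = -1 → ∀ w ∈ ((transverseStructure p S.ρbar S.jbar) (Sum.inr v)), (S.A k).thetaH1 (Sum.inr v) (S.cd.transportH1 S.ρbar v ((S.sigma_smul_eq_self_of_mem_L hy (S.enginePrimes_subset_L k hv)).symm ▸ w : galoisCohomology (S.ρbar.toLocal (Sum.inr (S.cd.σ • v))) 1)) = ε' • w → w ≠ 0 → ∀ b ∈ ((transverseStructure p S.ρbar S.jbar) (Sum.inr v)), (S.A k).thetaH1 (Sum.inr v) (S.cd.transportH1 S.ρbar v ((S.sigma_smul_eq_self_of_mem_L hy (S.enginePrimes_subset_L k hv)).symm ▸ b : galoisCohomology (S.ρbar.toLocal (Sum.inr (S.cd.σ • v))) 1)) = ε' • b → ∃ r : Rk k, b = galoisCohomology.scalarMapH1 (S.ρbar.toLocal (Sum.inr v)) (DualityDatum.isScalarLinear_toLocal (S.isScalarLinear_rhobar hy k) (Sum.inr v)) r w)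
    (hwitf : ∀ (v : HeightOneSpectrum (𝓞 K)) (hv : v ∈ S.enginePrimes k), ∀ ε' : ℤ, ε' = 1 ∨ ε' = -1 → ∃ w ∈ (((hy.h1 k).1.propagateStructure (S.t k).cond) (Sum.inr v)), w ≠ 0 ∧ (S.A k).thetaH1 (Sum.inr v) (S.cd.transportH1 S.ρbar v ((S.sigma_smul_eq_self_of_mem_L hy (S.enginePrimes_subset_L k hv)).symm ▸ w : galoisCohomology (S.ρbar.toLocal (Sum.inr (S.cd.σ • v))) 1)) = ε' • w)
    (hwitt : ∀ (v : HeightOneSpectrum (𝓞 K)) (hv : v ∈ S.enginePrimes k), ∀ ε' : ℤ, ε' = 1 ∨ ε' = -1 → ∃ w ∈ ((transverseStructure p S.ρbar S.jbar) (Sum.inr v)), w ≠ 0 ∧ (S.A k).thetaH1 (Sum.inr v) (S.cd.transportH1 S.ρbar v ((S.sigma_smul_eq_self_of_mem_L hy (S.enginePrimes_subset_L k hv)).symm ▸ w : galoisCohomology (S.ρbar.toLocal (Sum.inr (S.cd.σ • v))) 1)) = ε' • w)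
    (horth : ∀ (v : HeightOneSpectrum (𝓞 K)) (hv : v ∈ S.enginePrimes k), ∀ x y : galoisCohomology (S.ρbar.toLocal (Sum.inr v)) 1, (S.A k).thetaH1 (Sum.inr v) (S.cd.transportH1 S.ρbar v ((S.sigma_smul_eq_self_of_mem_L hy (S.enginePrimes_subset_L k hv)).symm ▸ x : galoisCohomology (S.ρbar.toLocal (Sum.inr (S.cd.σ • v))) 1)) = x → (S.A k).thetaH1 (Sum.inr v) (S.cd.transportH1 S.ρbar v ((S.sigma_smul_eq_self_of_mem_L hy (S.enginePrimes_subset_L k hv)).symm ▸ y : galoisCohomology (S.ρbar.toLocal (Sum.inr (S.cd.σ • v))) 1)) = -y → Dbar.localCup (Sum.inr v) x (S.cd.transportH1 S.ρbar v ((S.sigma_smul_eq_self_of_mem_L hy (S.enginePrimes_subset_L k hv)).symm ▸ y : galoisCohomology (S.ρbar.toLocal (Sum.inr (S.cd.σ • v))) 1)) = 0 ∧ Dbar.localCup (Sum.inr v) y (S.cd.transportH1 S.ρbar v ((S.sigma_smul_eq_self_of_mem_L hy (S.enginePrimes_subset_L k hv)).symm ▸ x : galoisCohomology (S.ρbar.toLocal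 (Sum.inr (S.cd.σ • v))) 1)) = 0)
    (hnd : ∀ (v : HeightOneSpectrum (𝓞 K)) (hv : v ∈ S.enginePrimes k), ∀ u : galoisCohomology (S.ρbar.toLocal (Sum.inr v)) 1, (∀ y, Dbar.localCup (Sum.inr v) u (S.cd.transportH1 S.ρbar v ((S.sigma_smul_eq_self_of_mem_L hy (S.enginePrimes_subset_L k hv)).symm ▸ y : galoisCohomology (S.ρbar.toLocal (Sum.inr (S.cd.σ • v))) 1)) = 0) → u = 0) :
    (∀ v ∈ S.enginePrimes k, v ∉ n →
      letI := (galoisCohomology.moduleH1 (S.ρbar.toLocal (Sum.inr v))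
        ((S.isScalarLinear_rhobar hy k).restrictField (Place.Completion (Sum.inr v))));
      Module.length (Rk k) ↥(galoisCohomology.submoduleOfStable ((S.isScalarLinear_rhobar hy k).restrictField (Place.Completion (Sum.inr v)))
        ((((((hy.h1 k).1.propagateStructure (S.t k).cond).modify (transverseStructure p S.ρbar S.jbar) {v} ∅ n).selmerGroup) ⊓
          (semilinearH S.cd.isLift (S.A k).θ.toAddMonoidHom (S.A k).isSemilinear 1 - AddMonoidHom.id _).ker).map
          (galoisCohomology.localization S.ρbar (Sum.inr v) 1))
        (scalarMapH1_mem_map_localization S.ρbar (S.isScalarLinear_rhobar hy k) (Sum.inr v) (scalarMapH1_mem_inf S.ρbar (S.isScalarLinear_rhobar hy k) (S.scalarMapH1_mem_residualSelmer_modify hy k {v} ∅ n) (S.scalarMapH1_mem_kerSub hy k)))) = 1) ∧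
    (∀ v ∈ S.enginePrimes k, v ∉ n →
      letI := (galoisCohomology.moduleH1 (S.ρbar.toLocal (Sum.inr v))
        ((S.isScalarLinear_rhobar hy k).restrictField (Place.Completion (Sum.inr v))));
      Module.length (Rk k) ↥(galoisCohomology.submoduleOfStable ((S.isScalarLinear_rhobar hy k).restrictField (Place.Completion (Sum.inr v)))
        ((((((hy.h1 k).1.propagateStructure (S.t k).cond).modify (transverseStructure p S.ρbar S.jbar) {v} ∅ n).selmerGroup) ⊓
          (semilinearH S.cd.isLift (S.A k).θ.toAddMonoidHom (S.A k).isSemilinear 1 + AddMonoidHom.id _).ker).map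
          (galoisCohomology.localization S.ρbar (Sum.inr v) 1))
        (scalarMapH1_mem_map_localization S.ρbar (S.isScalarLinear_rhobar hy k) (Sum.inr v) (scalarMapH1_mem_inf S.ρbar (S.isScalarLinear_rhobar hy k) (S.scalarMapH1_mem_residualSelmer_modify hy k {v} ∅ n) (S.scalarMapH1_mem_kerAdd hy k)))) = 1) ∧
    (∀ v ∈ S.enginePrimes k, v ∉ n →
      (((((hy.h1 k).1.propagateStructure (S.t k).cond).modify (transverseStructure p S.ρbar S.jbar) {v} ∅ n).selmerGroup) ⊓
          (semilinearH S.cd.isLift (S.A k).θ.toAddMonoidHom (S.A k).isSemilinear 1 - AddMonoidHom.id _).ker).map (galoisCohomology.localization S.ρbar (Sum.inr v) 1) ≤ (((hy.h1 k).1.propagateStructure (S.t k).cond) (Sum.inr v)) ∨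
      (((((hy.h1 k).1.propagateStructure (S.t k).cond).modify (transverseStructure p S.ρbar S.jbar) {v} ∅ n).selmerGroup) ⊓
          (semilinearH S.cd.isLift (S.A k).θ.toAddMonoidHom (S.A k).isSemilinear 1 - AddMonoidHom.id _).ker).map (galoisCohomology.localization S.ρbar (Sum.inr v) 1) ≤ ((transverseStructure p S.ρbar S.jbar) (Sum.inr v))) ∧
    (∀ v ∈ S.enginePrimes k, v ∉ n →
      (((((hy.h1 k).1.propagateStructure (S.t k).cond).modify (transverseStructure p S.ρbar S.jbar) {v} ∅ n).selmerGroup) ⊓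
          (semilinearH S.cd.isLift (S.A k).θ.toAddMonoidHom (S.A k).isSemilinear 1 + AddMonoidHom.id _).ker).map (galoisCohomology.localization S.ρbar (Sum.inr v) 1) ≤ (((hy.h1 k).1.propagateStructure (S.t k).cond) (Sum.inr v)) ∨
      (((((hy.h1 k).1.propagateStructure (S.t k).cond).modify (transverseStructure p S.ρbar S.jbar) {v} ∅ n).selmerGroup) ⊓
          (semilinearH S.cd.isLift (S.A k).θ.toAddMonoidHom (S.A k).isSemilinear 1 + AddMonoidHom.id _).ker).map (galoisCohomology.localization S.ρbar (Sum.inr v) 1) ≤ ((transverseStructure p S.ρbar S.jbar) (Sum.inr v))) := by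
  refine ⟨fun v hv hvn => ?_, fun v hv hvn => ?_, fun v hv hvn => ?_, fun v hv hvn => ?_⟩
  · exact (S.engine_gd_dich_at hy k Dbar hDbar hθ hn hv (hiso v hv hvn) (hcard v hv hvn) (hdis v hv) (hsplit v hv)
      (ht v hv) (hdecf v hv) (hdect v hv) (hlinef v hv) (hlinet v hv) (hwitf v hv) (hwitt v hv) (horth v hv)
      (hnd v hv)).1
  · exact (S.engine_gd_dich_at hy k Dbar hDbar hθ hn hv (hiso v hv hvn) (hcard v hv hvn) (hdis v hv) (hsplit v hv)
      (ht v hv) (hdecf v hv) (hdect v hv) (hlinef v hv) (hlinet v hv) (hwitf v hv) (hwitt v hv) (horth v hv)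
      (hnd v hv)).2.1
  · exact (S.engine_gd_dich_at hy k Dbar hDbar hθ hn hv (hiso v hv hvn) (hcard v hv hvn) (hdis v hv) (hsplit v hv)
      (ht v hv) (hdecf v hv) (hdect v hv) (hlinef v hv) (hlinet v hv) (hwitf v hv) (hwitt v hv) (horth v hv)
      (hnd v hv)).2.2.1
  · exact (S.engine_gd_dich_at hy k Dbar hDbar hθ hn hv (hiso v hv hvn) (hcard v hv hvn) (hdis v hv) (hsplit v hv)
      (ht v hv) (hdecf v hv) (hdect v hv) (hlinef v hv) (hlinet v hv) (hwitf v hv) (hwitt v hv) (horth v hv)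
      (hnd v hv)).2.2.2

end DVRSetting

end Literature.NumberTheory.GaloisCohomology.Howard2004

end
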